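import Summits.KontsevichZagierPeriods.KontsevichZagierPeriods.Theorems.MzvKernelInKZ.Negative.CalabiPolytope
import Summits.KontsevichZagierPeriods.KontsevichZagierPeriods.Theorems.MzvKernelInKZ.Negative.CalabiTwo

/-!
# `MzvKernelInKZ` (stmt-KontsevichZagierPeriods-3914): negative side — the Calabi map in dimension 4: Jacobian and injectivity

Companion of `Negative/CalabiPolytope.lean` and `Negative/CalabiTwo.lean`.  The Calabi map
`xᵢ = sin uᵢ / cos uᵢ₊₁` (cyclically, `n = 4`) in half-angle coordinates (`cal4`, rational): its
Jacobian matrix is cyclic bidiagonal with determinant **`∏ g(tᵢ) · (1 − ∏ xᵢ²)`**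
(`det_cal4Deriv`, Beukers–Kolk–Calabi's Jacobian `1 − x₁²x₂²x₃²x₄²` times `du/dt`), it maps `P₄`
into `(0,1)⁴`, and it is INJECTIVE on `P₄` by BKC's inversion formula
`sin²uᵢ · (1 − ∏xⱼ²) = xᵢ² − xᵢ²xᵢ₊₁² + xᵢ²xᵢ₊₁²xᵢ₊₂² − ∏xⱼ²` (`Sn_sq_formula`).  Surjectivity and
the move are in `CalabiFourOnto.lean`.

Sources: F. Beukers, J. A. C. Kolk, E. Calabi, *Sums of generalized harmonic series and volumes*, Nieuw Arch. Wisk. (4) 11 (1993), 217–224, proof of the Theorem (Jacobian and inverse); M. Kontsevich, D. Zagier, *Periods* (2001), §1.2.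
-/

noncomputable section

namespace Summit.KontsevichZagierPeriods.MzvKernelInKZ.Negative

open Set MeasureTheory MvPolynomial
open Literature.NumberTheory.Transcendental
open Literature.ModelTheory.ExponentialFields (IsSemialgebraic)

/-- The Calabi map `xᵢ = sin uᵢ / cos uᵢ₊₁` (cyclically) in half-angle coordinates. [folklore] -/
def cal4 (z : Fin 4 → ℝ) : Fin 4 → ℝ :=
  ![Sn (z 0) * (Cs (z 1))⁻¹, Sn (z 1) * (Cs (z 2))⁻¹, Sn (z 2) * (Cs (z 3))⁻¹, Sn (z 3) * (Cs (z 0))⁻¹]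

/-- Component `0` of the Calabi map. [folklore] -/
@[simp] theorem cal4_0 (z : Fin 4 → ℝ) : cal4 z 0 = Sn (z 0) * (Cs (z 1))⁻¹ := rfl
/-- Component `1` of the Calabi map. [folklore] -/
@[simp] theorem cal4_1 (z : Fin 4 → ℝ) : cal4 z 1 = Sn (z 1) * (Cs (z 2))⁻¹ := rfl
/-- Component `2` of the Calabi map. [folklore] -/
@[simp] theorem cal4_2 (z : Fin 4 → ℝ) : cal4 z 2 = Sn (z 2) * (Cs (z 3))⁻¹ := rfl
/-- Component `3` of the Calabi map. [folklore] -/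
@[simp] theorem cal4_3 (z : Fin 4 → ℝ) : cal4 z 3 = Sn (z 3) * (Cs (z 0))⁻¹ := rfl

/-- Diagonal and cyclic off-diagonal Jacobian entries. [folklore] -/
def cA (z : Fin 4 → ℝ) (i j : Fin 4) : ℝ := Cs (z i) * gq (z i) * (Cs (z j))⁻¹
/-- Cyclic off-diagonal Jacobian entry `∂xᵢ/∂tⱼ = sin uᵢ sin uⱼ g(tⱼ)/cos² uⱼ`. [folklore] -/
def cB (z : Fin 4 → ℝ) (i j : Fin 4) : ℝ := Sn (z i) * (Sn (z j) * gq (z j) / Cs (z j) ^ 2)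

/-- The Jacobian matrix (cyclic bidiagonal). [folklore] -/
def cal4Jac (z : Fin 4 → ℝ) : Matrix (Fin 4) (Fin 4) ℝ :=
  !![cA z 0 1, cB z 0 1, 0, 0;
     0, cA z 1 2, cB z 1 2, 0;
     0, 0, cA z 2 3, cB z 2 3;
     cB z 3 0, 0, 0, cA z 3 0]

/-- The derivative of the Calabi map. [folklore] -/
def cal4Deriv (z : Fin 4 → ℝ) : (Fin 4 → ℝ) →L[ℝ] (Fin 4 → ℝ) :=
  LinearMap.toContinuousLinearMap (Matrix.toLin' (cal4Jac z))

/-- Laplace expansion of the cyclic bidiagonal Jacobian: `∏ diagonal − ∏ off-diagonal`. [folklore] -/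
theorem det_cal4Jac_aux (z : Fin 4 → ℝ) :
    (cal4Jac z).det = cA z 0 1 * cA z 1 2 * cA z 2 3 * cA z 3 0 - cB z 0 1 * cB z 1 2 * cB z 2 3 * cB z 3 0 := by
  have e : Fin.succAbove (1 : Fin 4) (2 : Fin 3) = 3 := by decide
  have v1 : (![0, cA z 1 2, cB z 1 2, 0] : Fin 4 → ℝ) 3 = 0 := rfl
  have v2 : (![0, 0, cA z 2 3, cB z 2 3] : Fin 4 → ℝ) 3 = cB z 2 3 := rfl
  simp [cal4Jac, Matrix.det_succ_row_zero, Fin.sum_univ_succ, e, v1, v2]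
  ring

/-- **The Jacobian of the Calabi map is `∏ g(tᵢ) · (1 − ∏ xᵢ²)`** (Beukers–Kolk–Calabi, `n = 4`). [folklore] -/
theorem det_cal4Deriv {z : Fin 4 → ℝ} (h : ∀ i, Cs (z i) ≠ 0) :
    (cal4Deriv z).det = gq (z 0) * gq (z 1) * (gq (z 2) * gq (z 3)) *
      (1 - (cal4 z 0) ^ 2 * (cal4 z 1) ^ 2 * (cal4 z 2) ^ 2 * (cal4 z 3) ^ 2) := by
  have hd : (cal4Jac z).det = gq (z 0) * gq (z 1) * (gq (z 2) * gq (z 3)) *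
      (1 - (cal4 z 0) ^ 2 * (cal4 z 1) ^ 2 * (cal4 z 2) ^ 2 * (cal4 z 3) ^ 2) := by
    have h0 := h 0; have h1 := h 1; have h2 := h 2; have h3 := h 3
    rw [det_cal4Jac_aux]
    simp only [cA, cB, cal4_0, cal4_1, cal4_2, cal4_3]
    field_simp
  rw [← hd]; exact LinearMap.det_toLin' _

/-- Differentiability of `cal4` with the stated derivative. [folklore] -/
theorem hasFDerivAt_cal4 {z : Fin 4 → ℝ} (h : ∀ i, Cs (z i) ≠ 0) : HasFDerivAt cal4 (cal4Deriv z) z := by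
  have p : ∀ i : Fin 4, HasFDerivAt (fun y : Fin 4 → ℝ => y i)
      (ContinuousLinearMap.proj (R := ℝ) (φ := fun _ : Fin 4 => ℝ) i) z := fun i => hasFDerivAt_apply i z
  have sd := fun i : Fin 4 => (hasDerivAt_Sn (z i)).comp_hasFDerivAt z (p i)
  have id := fun i : Fin 4 => (hasDerivAt_inv_Cs (h i)).comp_hasFDerivAt z (p i)
  have c0 : HasFDerivAt (fun y : Fin 4 → ℝ => cal4 y 0) ((ContinuousLinearMap.proj 0).comp (cal4Deriv z)) z := by
    refine ((sd 0).mul (id 1)).congr_fderiv ?_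
    ext v; simp [cal4Deriv, cal4Jac, cA, cB, dotProduct, Fin.sum_univ_four]; ring
  have c1 : HasFDerivAt (fun y : Fin 4 → ℝ => cal4 y 1) ((ContinuousLinearMap.proj 1).comp (cal4Deriv z)) z := by
    refine ((sd 1).mul (id 2)).congr_fderiv ?_
    ext v; simp [cal4Deriv, cal4Jac, cA, cB, dotProduct, Fin.sum_univ_four]; ring
  have c2 : HasFDerivAt (fun y : Fin 4 → ℝ => cal4 y 2) ((ContinuousLinearMap.proj 2).comp (cal4Deriv z)) z := by
    refine ((sd 2).mul (id 3)).congr_fderiv ?_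
    ext v; simp [cal4Deriv, cal4Jac, cA, cB, dotProduct, Fin.sum_univ_four]; ring
  have c3 : HasFDerivAt (fun y : Fin 4 → ℝ => cal4 y 3) ((ContinuousLinearMap.proj 3).comp (cal4Deriv z)) z := by
    refine ((sd 3).mul (id 0)).congr_fderiv ?_
    ext v; simp [cal4Deriv, cal4Jac, cA, cB, dotProduct, Fin.sum_univ_four]; ring
  rw [hasFDerivAt_pi']
  intro i; fin_cases i
  · exact c0
  · exact c1
  · exact c2
  · exact c3

/-- Basic facts on `P₄`: all `zᵢ ∈ (0,1)`, `sin uᵢ < cos uᵢ₊₁`. [folklore] -/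
theorem P4_facts {z : Fin 4 → ℝ} (hz : z ∈ P4set) :
    (∀ i, z i ∈ Ioo (0 : ℝ) 1) ∧ Sn (z 0) < Cs (z 1) ∧ Sn (z 1) < Cs (z 2) ∧ Sn (z 2) < Cs (z 3) ∧
      Sn (z 3) < Cs (z 0) := by
  obtain ⟨hb, c01, c12, c23, c30⟩ := mem_P4set.mp hz
  have hb' : ∀ i, z i ∈ Ioo (0 : ℝ) 1 := fun i => ⟨(hb i).1, (hb i).2⟩
  have key : ∀ i j : Fin 4, cz z i j → Sn (z i) < Cs (z j) := by
    intro i j c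
    have hj := hb' j
    rw [← Sn_rho (show z j ≠ -1 by linarith [hj.1])]
    exact (Sn_lt_Sn_iff (hb' i) (rho_mem_Ioo hj)).mpr ((cz_iff_lt_rho (by linarith [hj.1])).mp c)
  exact ⟨hb', key 0 1 c01, key 1 2 c12, key 2 3 c23, key 3 0 c30⟩

/-- Auxiliary lemma `cal4_mem_cube` (see the module docstring). [folklore] -/
theorem cal4_mem_cube {z : Fin 4 → ℝ} (hz : z ∈ P4set) : cal4 z ∈ openUnitCube 4 := by
  obtain ⟨hb, l0, l1, l2, l3⟩ := P4_facts hz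
  have s := fun i => Sn_pos (hb i)
  have c := fun i => Cs_pos (hb i)
  rw [mem_cube4']
  intro i
  fin_cases i
  · exact ⟨by simp; exact mul_pos (s 0) (inv_pos.mpr (c 1)), by
      simp; rw [← div_eq_mul_inv, div_lt_one (c 1)]; exact l0⟩
  · exact ⟨by simp; exact mul_pos (s 1) (inv_pos.mpr (c 2)), by
      simp; rw [← div_eq_mul_inv, div_lt_one (c 2)]; exact l1⟩
  · exact ⟨by simp; exact mul_pos (s 2) (inv_pos.mpr (c 3)), by
      simp; rw [← div_eq_mul_inv, div_lt_one (c 3)]; exact l2⟩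
  · exact ⟨by simp; exact mul_pos (s 3) (inv_pos.mpr (c 0)), by
      simp; rw [← div_eq_mul_inv, div_lt_one (c 0)]; exact l3⟩

/-- `cos² = 1 − sin²`. [folklore] -/
theorem Cs_sq (t : ℝ) : Cs t ^ 2 = 1 - Sn t ^ 2 := by linarith [Sn_sq_add_Cs_sq t]

/-- `xᵢ² = sin²uᵢ / (1 − sin²uᵢ₊₁)`. [folklore] -/
theorem cal4_sq (z : Fin 4 → ℝ) :
    (cal4 z 0) ^ 2 = Sn (z 0) ^ 2 / (1 - Sn (z 1) ^ 2) ∧ (cal4 z 1) ^ 2 = Sn (z 1) ^ 2 / (1 - Sn (z 2) ^ 2) ∧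
    (cal4 z 2) ^ 2 = Sn (z 2) ^ 2 / (1 - Sn (z 3) ^ 2) ∧ (cal4 z 3) ^ 2 = Sn (z 3) ^ 2 / (1 - Sn (z 0) ^ 2) := by
  refine ⟨?_, ?_, ?_, ?_⟩ <;> simp [mul_pow, inv_pow, Cs_sq, div_eq_mul_inv]

/-- The product `∏ xᵢ² < 1` on the image. [folklore] -/
theorem prod_sq_lt_one {x : Fin 4 → ℝ} (hx : x ∈ openUnitCube 4) :
    x 0 ^ 2 * x 1 ^ 2 * x 2 ^ 2 * x 3 ^ 2 < 1 := by
  rw [mem_cube4'] at hx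
  have q : ∀ i, 0 < x i ^ 2 ∧ x i ^ 2 < 1 := fun i => ⟨pow_pos (hx i).1 2, by nlinarith [(hx i).1, (hx i).2]⟩
  have h01 := mul_lt_one_of_nonneg_of_lt_one_left (q 0).1.le (q 0).2 (q 1).2.le
  have h012 := mul_lt_one_of_nonneg_of_lt_one_left (mul_pos (q 0).1 (q 1).1).le h01 (q 2).2.le
  exact mul_lt_one_of_nonneg_of_lt_one_left (mul_pos (mul_pos (q 0).1 (q 1).1) (q 2).1).le h012 (q 3).2.le

/-- **BKC's inversion formula**: `sin²u₀ · (1 − ∏xᵢ²) = x₀² − x₀²x₁² + x₀²x₁²x₂² − ∏xᵢ²`, and cyclically. [folklore] -/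
theorem Sn_sq_formula {z : Fin 4 → ℝ} (hz : z ∈ P4set) :
    let x := cal4 z
    let X := x 0 ^ 2 * x 1 ^ 2 * x 2 ^ 2 * x 3 ^ 2
    Sn (z 0) ^ 2 * (1 - X) = x 0 ^ 2 - x 0 ^ 2 * x 1 ^ 2 + x 0 ^ 2 * x 1 ^ 2 * x 2 ^ 2 - X ∧
    Sn (z 1) ^ 2 * (1 - X) = x 1 ^ 2 - x 1 ^ 2 * x 2 ^ 2 + x 1 ^ 2 * x 2 ^ 2 * x 3 ^ 2 - X ∧
    Sn (z 2) ^ 2 * (1 - X) = x 2 ^ 2 - x 2 ^ 2 * x 3 ^ 2 + x 2 ^ 2 * x 3 ^ 2 * x 0 ^ 2 - X ∧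
    Sn (z 3) ^ 2 * (1 - X) = x 3 ^ 2 - x 3 ^ 2 * x 0 ^ 2 + x 3 ^ 2 * x 0 ^ 2 * x 1 ^ 2 - X := by
  intro x X
  obtain ⟨hb, -⟩ := P4_facts hz
  obtain ⟨e0, e1, e2, e3⟩ := cal4_sq z
  have n : ∀ i, 1 - Sn (z i) ^ 2 ≠ 0 := fun i => by
    have := Sn_lt_one (hb i); have := Sn_pos (hb i); nlinarith
  have n0 := n 0; have n1 := n 1; have n2 := n 2; have n3 := n 3
  simp only [X, x]
  rw [e0, e1, e2, e3]
  refine ⟨?_, ?_, ?_, ?_⟩ <;> field_simp <;> ring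

/-- `cal4` is injective on its domain. [folklore] -/
theorem injOn_cal4 : InjOn cal4 P4set := by
  intro z hz z' hz' h
  obtain ⟨hb, -⟩ := P4_facts hz
  obtain ⟨hb', -⟩ := P4_facts hz'
  obtain ⟨k0, k1, k2, k3⟩ := Sn_sq_formula hz
  obtain ⟨k0', k1', k2', k3'⟩ := Sn_sq_formula hz'
  have hX : 0 < 1 - (cal4 z' 0) ^ 2 * (cal4 z' 1) ^ 2 * (cal4 z' 2) ^ 2 * (cal4 z' 3) ^ 2 := by
    linarith [prod_sq_lt_one (cal4_mem_cube hz')]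
  rw [h] at k0 k1 k2 k3
  have sq : ∀ i, Sn (z i) ^ 2 = Sn (z' i) ^ 2 → z i = z' i := fun i hs => by
    have := Sn_pos (hb i); have := Sn_pos (hb' i)
    exact Sn_inj (hb i) (hb' i) (by nlinarith)
  funext i; fin_cases i
  · exact sq 0 (mul_right_cancel₀ hX.ne' (k0.trans k0'.symm))
  · exact sq 1 (mul_right_cancel₀ hX.ne' (k1.trans k1'.symm))
  · exact sq 2 (mul_right_cancel₀ hX.ne' (k2.trans k2'.symm))
  · exact sq 3 (mul_right_cancel₀ hX.ne' (k3.trans k3'.symm))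

end Summit.KontsevichZagierPeriods.MzvKernelInKZ.Negative
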